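import Literature.MathematicalPhysics.QuantumLattice.HubbardNNNHoppingWindowCertificate
import HarnessLib

/-!
# Generic-sector translation-averaged certificate on the fermionic torus (the SU(2)-Ward slot)

HONEST FRAMING: first certified bounds; not a superconductivity verdict. This file proves NO number: it is a
soundness REFACTOR of `HubbardNNNHoppingWindowCertificate`'s generic torus theorem (motivated by the Ventures crux lines
`wardk` / `symd3` / `fo_dual_rounding` on item stmt-Ventures-21721, whose SU(2)-Ward stubs close from it by `exact`;
written by hub-lb-sym-eng-3, team lb-sym). Known mathematics only: Han 2020 §2–3 read in the tracial sector ground state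
of the periodic box (Bratteli–Robinson II §6.2.4), exactly as the parent file.

## What it is
`Literature.MathematicalPhysics.QuantumLattice.torus_minEnergyOn_div_ge_of_local_certificate` (Han 2020 §2–3 read in the
tracial sector ground state of the periodic box) hard-codes the symmetry sector `K = szSector (2n) 0`; its proof uses
`K` only through (a) `K ≠ ⊥`, (b)/(c) invariance of `K` under the translation unitaries `U_v = fockTranslate v` and their
adjoints (everything else goes through the abstract layer `Matrix.re_projState_ge_of_local_certificate`, which is already
generic in `K`). Here the three uses become hypotheses `hK`, `hKT`, `hKT'`, so that ANY nonzero `A`- and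
translation-invariant subspace is admissible — in particular the full `N`-particle sector `nParticleSubmodule N`, on
which the SU(2) ladder operators `S^±` act (they do NOT preserve `szSector (2n) 0`): this is the slot the SU(2)-Ward null
family `ω([S^±, X]) = 0` of the certificates of record (CORE #294, MENU #529, F3′a members) needs (stubs W2/W3 of `wardk`).

* `torus_minEnergyOn_div_ge_of_local_certificate_generic` — the theorem; ALL binders explicit, index types in `Type`
  (the normal form of the crux-line stub `GenericSectorTorusCert`, so it closes by `exact`);
* the proof is the parent proof of the `szSector` version verbatim with the three `szSector` facts replaced by hypotheses.

Deliberately NOT here: the instantiation at `K = nParticleSubmodule N` with the `S^±` Ward families and the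
thermodynamic limit (stubs W2/W3 of `wardk`; they belong with `HubbardNNNHoppingWindowCertificateD4`). No summit statement
is proved here; a certified bound is a number with a certificate; nothing here predicts superconductivity.
-/

noncomputable section

open Matrix Finset
open scoped ComplexOrder BigOperators

namespace Literature.MathematicalPhysics.QuantumLattice

open HubbardWave0
open Literature.Probability.LatticeModels
open Literature.MathematicalPhysics.QuantumManyBody.StateRelaxation

/-- (Local to this file, as in `HubbardNNNHoppingWindowCertificate` / `HubbardWindowCertificate`.) Torus sites are
compared through the linear order, the instance carried by the orbital-generic lemmas. [folklore] -/
local instance (priority := high) instDecidableEqFermionTorusGenericSector {d L : ℕ} :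
    DecidableEq (FermionTorus d L) := LinearOrder.toDecidableEq

/-- **Translation-averaged certificate ⇒ sector ground-state energy per site, for an ARBITRARY invariant sector `K`
(generic sector `K`).** Let `A` be a Hermitian operator on the Fock space of the
fermionic torus `(ℤ/Lℤ)^d`, `K ≠ ⊥` a subspace invariant under `A`, under every translation unitary
`U_v = fockTranslate v` and under every `U_vᴴ`, with `U_v A = A U_v`. Suppose the translates of a local energy `X` sum to
`A`, the translates of constraint observables `Dᵢ` sum to Hermitian `Gᵢ` acting as the real scalars `gᵢ` on `K`, and the
torus algebra carries the identity
`X − c·1 − Σᵢ μᵢ (Dᵢ − νᵢ·1) = Σ Λₐᵦ Oₐᴴ O_b + (Σₖ (A Xₖ − Xₖ A) + Σₗ (Uₗ Yₗ Uₗᴴ − Yₗ)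
  + Σᵣ (Zᵣ (Qᵣ − qᵣ) + (Qᵣ − qᵣ) Z'ᵣ) + Σⱼ (Cⱼ Wⱼ − Wⱼ Cⱼ)) + (Σₘ dₘ • (Vₘᴴ − Vₘ) + Σₖ aₖ • Mₖ)`
with `Λ ⪰ 0`, symmetries `Uₗ` / charges `Cⱼ` commuting with `A` and (with their adjoints) preserving `K`, `Uₗᴴ Uₗ = 1`,
Hermitian `Qᵣ = qᵣ` on `K`, real `dₘ`, contractions `Mₖ`. Then
`c − Σₖ ‖aₖ‖ + Σᵢ μᵢ (gᵢ / L^d − νᵢ) ≤ minEnergyOn A K / L^d`.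
This is `torus_minEnergyOn_div_ge_of_local_certificate` (the case `K = szSector (2n) 0`) with its three uses of that
particular sector (`szSector_ne_bot`, `fockTranslate_mulVec_mem_szSector`, `fockTranslate_conjTranspose_mulVec_mem_szSector`)
turned into the hypotheses `_hK`, `_hKT`, `_hKT'`, so that e.g. the full `N`-particle sector `nParticleSubmodule N` (on
which the SU(2) ladder operators `S^±` act; they do not preserve `szSector`) is admissible — the slot an SU(2)-Ward null
family `ω([S^±, X]) = 0` needs. Binder list = the Ventures crux-line stub `GenericSectorTorusCert` (closes by `exact`).
Han 2020 §2–3 (translation-invariant bootstrap in the tracial sector ground state of the periodic box).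
[cite: Han2020Bootstrap, §3] -/
theorem torus_minEnergyOn_div_ge_of_local_certificate_generic :
    ∀ (d L : ℕ) [NeZero L]
    (A : Matrix (Finset (Orb (FermionTorus d L))) (Finset (Orb (FermionTorus d L))) ℂ) (_hA : A.IsHermitian)
    (K : Submodule ℂ (Fock (Orb (FermionTorus d L)))) (_hK : K ≠ ⊥)
    (_hKA : ∀ ψ ∈ K, A *ᵥ ψ ∈ K)
    (_hKT : ∀ v : TorusSite d L, ∀ ψ ∈ K, (fockTranslate v).val *ᵥ ψ ∈ K)
    (_hKT' : ∀ v : TorusSite d L, ∀ ψ ∈ K, (fockTranslate v).valᴴ *ᵥ ψ ∈ K)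
    (_hAT : ∀ v : TorusSite d L, (fockTranslate v).val * A = A * (fockTranslate v).val)
    (X : Matrix (Finset (Orb (FermionTorus d L))) (Finset (Orb (FermionTorus d L))) ℂ)
    (_hsum : ∑ v : TorusSite d L, (fockTranslate v).val * X * (fockTranslate v).valᴴ = A)
    (δ' : Type) (dens : Finset δ') (μ ν g : δ' → ℝ)
    (D G : δ' → Matrix (Finset (Orb (FermionTorus d L))) (Finset (Orb (FermionTorus d L))) ℂ)
    (_hD : ∀ i ∈ dens, ∑ v : TorusSite d L, (fockTranslate v).val * D i * (fockTranslate v).valᴴ = G i)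
    (_hGh : ∀ i ∈ dens, (G i).IsHermitian)
    (_hG : ∀ i ∈ dens, ∀ ψ ∈ K, G i *ᵥ ψ = ((g i : ℝ) : ℂ) • ψ)
    (m : Type) (_ : Fintype m) (_ : DecidableEq m) (Λm : Matrix m m ℂ) (_hΛ : Λm.PosSemidef)
    (O : m → Matrix (Finset (Orb (FermionTorus d L))) (Finset (Orb (FermionTorus d L))) ℂ)
    (κ : Type) (s : Finset κ) (Xc : κ → Matrix (Finset (Orb (FermionTorus d L))) (Finset (Orb (FermionTorus d L))) ℂ)
    (ι : Type) (tt : Finset ι) (Us Y : ι → Matrix (Finset (Orb (FermionTorus d L))) (Finset (Orb (FermionTorus d L))) ℂ)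
    (_hU : ∀ l ∈ tt, Us l * A = A * Us l)
    (_hUK : ∀ l ∈ tt, ∀ ψ ∈ K, Us l *ᵥ ψ ∈ K)
    (_hUK' : ∀ l ∈ tt, ∀ ψ ∈ K, (Us l)ᴴ *ᵥ ψ ∈ K)
    (_hUU : ∀ l ∈ tt, (Us l)ᴴ * Us l = 1)
    (ρ : Type) (r : Finset ρ) (Q Z Z' : ρ → Matrix (Finset (Orb (FermionTorus d L))) (Finset (Orb (FermionTorus d L))) ℂ)
    (q : ρ → ℝ)
    (_hQh : ∀ i ∈ r, (Q i).IsHermitian)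
    (_hQ : ∀ i ∈ r, ∀ ψ ∈ K, Q i *ᵥ ψ = ((q i : ℝ) : ℂ) • ψ)
    (γ : Type) (u : Finset γ) (C W : γ → Matrix (Finset (Orb (FermionTorus d L))) (Finset (Orb (FermionTorus d L))) ℂ)
    (_hC : ∀ j ∈ u, C j * A = A * C j)
    (_hCK : ∀ j ∈ u, ∀ ψ ∈ K, C j *ᵥ ψ ∈ K)
    (_hCK' : ∀ j ∈ u, ∀ ψ ∈ K, (C j)ᴴ *ᵥ ψ ∈ K)
    (δ : Type) (ah : Finset δ) (dc : δ → ℝ) (V : δ → Matrix (Finset (Orb (FermionTorus d L))) (Finset (Orb (FermionTorus d L))) ℂ)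
    (κ'' : Type) (w : Finset κ'') (a : κ'' → ℂ)
    (M : κ'' → Matrix (Finset (Orb (FermionTorus d L))) (Finset (Orb (FermionTorus d L))) ℂ)
    (_hM : ∀ k ∈ w, (M k).IsContraction) (c : ℝ),
    X - (c : ℂ) • (1 : Matrix (Finset (Orb (FermionTorus d L))) (Finset (Orb (FermionTorus d L))) ℂ) -
        ∑ i ∈ dens, ((μ i : ℝ) : ℂ) • (D i - ((ν i : ℝ) : ℂ) •
          (1 : Matrix (Finset (Orb (FermionTorus d L))) (Finset (Orb (FermionTorus d L))) ℂ)) =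
      gramForm Λm O +
        (∑ k ∈ s, (A * Xc k - Xc k * A) +
          ∑ l ∈ tt, (Us l * Y l * (Us l)ᴴ - Y l) +
          ∑ i ∈ r, (Z i * (Q i - ((q i : ℝ) : ℂ) • 1) + (Q i - ((q i : ℝ) : ℂ) • 1) * Z' i) +
          ∑ j ∈ u, (C j * W j - W j * C j)) +
        (∑ m' ∈ ah, ((dc m' : ℝ) : ℂ) • ((V m')ᴴ - V m') + ∑ k ∈ w, a k • M k) →
    c - ∑ k ∈ w, ‖a k‖ + ∑ i ∈ dens, μ i * (g i / (L : ℝ) ^ d - ν i) ≤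
      A.minEnergyOn K / (L : ℝ) ^ d := by
  intro d L _ A hA K hK hKA hKT hKT' hAT X hsum δ' dens μ ν g D G hD hGh hG m _ _ Λm hΛ O κ s Xc ι tt Us Y
    hU hUK hUK' hUU ρ r Q Z Z' q hQh hQ γ u C W hC hCK hCK' δ ah dc V κ'' w a M hM c hcert
  -- the objective with the density constraints folded in
  set X' := X - ∑ i ∈ dens, ((μ i : ℝ) : ℂ) • (D i - ((ν i : ℝ) : ℂ) •
    (1 : Matrix (Finset (Orb (FermionTorus d L))) (Finset (Orb (FermionTorus d L))) ℂ)) with hX'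
  have hcert' : X' - (c : ℂ) • (1 : Matrix (Finset (Orb (FermionTorus d L))) (Finset (Orb (FermionTorus d L))) ℂ) =
      gramForm Λm O +
        (∑ k ∈ s, (A * Xc k - Xc k * A) + ∑ l ∈ tt, (Us l * Y l * (Us l)ᴴ - Y l) +
          ∑ i ∈ r, (Z i * (Q i - ((q i : ℝ) : ℂ) • 1) + (Q i - ((q i : ℝ) : ℂ) • 1) * Z' i) +
          ∑ j ∈ u, (C j * W j - W j * C j)) +
        (∑ m' ∈ ah, ((dc m' : ℝ) : ℂ) • ((V m')ᴴ - V m') + ∑ k ∈ w, a k • M k) := by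
    rw [hX', sub_right_comm]
    exact hcert
  have h := Matrix.re_projState_ge_of_local_certificate hA K hKA hK X' hΛ O s Xc tt Us Y hU hUK hUK'
    hUU r Q Z Z' q hQh hQ u C W hC hCK hCK' ah dc V w a M hM hcert'
  -- evaluation of the objective and of the constraint observables in the tracial state
  set P := A.sectorGroundProj K with hP
  have hPh : P.IsHermitian := sectorGroundProj_isHermitian A K
  have hP2 : P * P = P := sectorGroundProj_mul_self A K
  have hP0 : P ≠ 0 := sectorGroundProj_ne_zero hA K hKA hK
  have hPA : P * A = ((A.minEnergyOn K : ℝ) : ℂ) • P := sectorGroundProj_mul hA K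
  set ω := P.projState with hω
  have hone : ω 1 = 1 := projState_one hPh hP2 hP0
  have hPT : ∀ v : TorusSite d L, P * (fockTranslate v).val = (fockTranslate v).val * P := fun v =>
    sectorGroundProj_commute hA K (hAT v) (fun ψ hψ => hKT v ψ hψ) (fun ψ hψ => hKT' v ψ hψ)
  have hTT : ∀ v : TorusSite d L, (fockTranslate v).valᴴ * (fockTranslate v).val = 1 :=
    fockTranslate_conjTranspose_mul_self
  have hωX : ω X = ((A.minEnergyOn K : ℝ) : ℂ) / (Fintype.card (TorusSite d L) : ℂ) :=
    projState_eq_div_of_sum_conj hPh hP2 hP0 hPA (fun v => (fockTranslate v).val) hPT hTT hsum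
  have hωD : ∀ i ∈ dens, ω (D i) = ((g i : ℝ) : ℂ) / (Fintype.card (TorusSite d L) : ℂ) := by
    intro i hi
    have hPG : P * G i = ((g i : ℝ) : ℂ) • P := by
      have h0 := sectorGroundProj_mul_sub_smul A K (hGh i hi) (hG i hi)
      rw [Matrix.mul_sub, Matrix.mul_smul, Matrix.mul_one, sub_eq_zero] at h0
      exact h0
    exact projState_eq_div_of_sum_conj hPh hP2 hP0 hPG (fun v => (fockTranslate v).val) hPT hTT (hD i hi)
  have hωX' : ω X' = ((A.minEnergyOn K : ℝ) : ℂ) / (Fintype.card (TorusSite d L) : ℂ) -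
      ∑ i ∈ dens, ((μ i : ℝ) : ℂ) * (((g i : ℝ) : ℂ) / (Fintype.card (TorusSite d L) : ℂ) - ((ν i : ℝ) : ℂ)) := by
    rw [hX', map_sub, map_sum, hωX]
    congr 1
    refine Finset.sum_congr rfl fun i hi => ?_
    rw [map_smul, map_sub, map_smul, hone, hωD i hi, smul_eq_mul, smul_eq_mul, mul_one]
  have hre : (ω X').re = A.minEnergyOn K / (L : ℝ) ^ d - ∑ i ∈ dens, μ i * (g i / (L : ℝ) ^ d - ν i) := by
    rw [hωX', card_torusSite]
    have e : ((A.minEnergyOn K : ℝ) : ℂ) / ((L ^ d : ℕ) : ℂ) -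
        ∑ i ∈ dens, ((μ i : ℝ) : ℂ) * (((g i : ℝ) : ℂ) / ((L ^ d : ℕ) : ℂ) - ((ν i : ℝ) : ℂ)) =
        ((A.minEnergyOn K / (L : ℝ) ^ d - ∑ i ∈ dens, μ i * (g i / (L : ℝ) ^ d - ν i) : ℝ) : ℂ) := by
      push_cast
      rfl
    rw [e, Complex.ofReal_re]
  rw [hre] at h
  linarith

end Literature.MathematicalPhysics.QuantumLattice

end
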